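import Summits.HubbardSuperconductivity.HubbardSuperconductivity.Theorems.AnisotropyChordTransferFibre3N1RowSpecFacts
import Summits.HubbardSuperconductivity.HubbardSuperconductivity.Theorems.AnisotropyChordTransferFibre3N1RowCheckSound
import Summits.HubbardSuperconductivity.HubbardSuperconductivity.Theorems.AnisotropyChordTransferFibre3KT1Targets

/-!
# Route `AnisotropyChord` / H0 rotor rung, LEVEL 2 row `N₁`: the TRUE extended vector and its spec memberships (`M₂ = 2`)

`…N1RowCheckSound.n1CellCheck_sound` asks for a real vector `X` in the cell box whose staged coordinates satisfy the specs
`…N1RowExprC.specs 2` (hypothesis `hsp`).  THIS FILE defines that vector for a two-magnon profile — `xTrue L Δ lam2 f a`: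
coordinates `0–15` = `L2.point L λ₂ a` (`…Fibre3L2Vars`), `16 = ê₁ = (1 − cos θ)/θ²`, `17 = ε*(ε̂₃)` (`…N1RowSpecFacts.epsStarR`,
the repaired-slope energy), `18 = cos(θ/2)`, `19–66 = ĝ(q) = θ²g(q)` over the grid `gridPts 3` (48 points, `|q|∞ ≤ 3`, `q ≠ 0`),
`67–114 = t̂(q) = θ²t(q)` (`tfun`), `115–117 = cos(mθ)`, `118–120 = w_n = (1 − cos nθ)/θ²`, `0` beyond — and proves ★ `xTrue_specs`:
every spec inequality holds at `xTrue`, GIVEN the tail-block inequalities as a hypothesis (`TtSpecs`, discharged from `TtailBounds` +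
the manifold dictionary in `…N1RowTrueVecTail`).  Ingredients: `SpecsIneq` (inequality-only spec predicate; `append`/`map`/`get`),
the trigonometric memberships of `…N1RowSpecFacts`, `L2.ghat_bounds` (moved from `point` to `xTrue` by `eval_congr_below`), and the
kernel facts `gridPts_three_window` / `length_gridPts_three` (`decide`).
Prover seat `hubbard-h0-rotor-p2` g4; helper for piece A = stmt-HubbardSuperconductivity-23918 of rung 19089
(`--supports`, helper class).  Nothing here proves superconductivity in the Hubbard model; helper lemmas of ONE conditional
reduction (the GM₃ ∀L certificate, Level-2 row `N₁`); the rotor TARGET as originally worded stays FALSE (g15 verdict).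
Mathlib + the tree only; no sorry.
-/

set_option linter.dupNamespace false
set_option autoImplicit false

open Literature.Analysis.ValidatedNumerics

namespace Summit.HubbardSuperconductivity.HubbardSuperconductivity.Theorems.AnisotropyChord.Transfer.Fibre3.L2.N1

/-! ## Kernel facts about the grid `|q|∞ ≤ 3` -/

/-- the grid has 48 points. -/
theorem length_gridPts_three : (gridPts 3).length = 48 := by decide

/-- every grid point lies in the window `zWindow 3`. -/
theorem gridPts_three_window : ∀ q ∈ gridPts 3, q ∈ zWindow 3 := by decide

/-! ## The true extended vector (`M₂ = 2`, `M = 3`) -/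

/-- ★ the true Level-2 vector of a profile (see the module header for the coordinate table). -/
noncomputable def xTrue (L : ℕ) [NeZero L] (Δ lam2 : ℝ) (f : Tor L → ℝ) (a : ℝ) : ℕ → ℝ := fun i =>
  let θ : ℝ := 2 * Real.pi / L
  let P := L2.point L lam2 a
  if i < 16 then P i
  else if i = 16 then (1 - Real.cos θ) / θ ^ 2
  else if i = 17 then epsStarR (P 2) (P 3) (eps.eval P) (uu.eval P) ((1 - Real.cos ((3 : ℕ) * θ)) / θ ^ 2)
  else if i = 18 then Real.cos (θ / 2)
  else if i < 67 then θ ^ 2 * gres L lam2 (B1.toTor L ((gridPts 3).getD (i - 19) (0, 0)))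
  else if i < 115 then θ ^ 2 * tfun L Δ f (B1.toTor L ((gridPts 3).getD (i - 67) (0, 0)))
  else if i < 118 then Real.cos (((i - 114 : ℕ) : ℝ) * θ)
  else if i < 121 then (1 - Real.cos (((i - 117 : ℕ) : ℝ) * θ)) / θ ^ 2
  else 0

variable (L : ℕ) [NeZero L] (Δ lam2 : ℝ) (f : Tor L → ℝ) (a : ℝ)

/-- below `16` the true vector is the Level-2 point. -/
theorem xTrue_lt16 {i : ℕ} (hi : i < 16) : xTrue L Δ lam2 f a i = L2.point L lam2 a i := by
  unfold xTrue; simp only [if_pos hi]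

/-- coordinate `0` is `θ²`. -/
theorem xTrue_zero : xTrue L Δ lam2 f a 0 = (2 * Real.pi / L) ^ 2 := by
  rw [xTrue_lt16 L Δ lam2 f a (by norm_num)]; rfl

/-- coordinate `16`. -/
theorem xTrue_16 : xTrue L Δ lam2 f a 16 = (1 - Real.cos (2 * Real.pi / L)) / (2 * Real.pi / L) ^ 2 := by
  unfold xTrue; simp

/-- coordinate `17`. -/
theorem xTrue_17 : xTrue L Δ lam2 f a 17 =
    epsStarR (L2.point L lam2 a 2) (L2.point L lam2 a 3) (eps.eval (L2.point L lam2 a)) (uu.eval (L2.point L lam2 a))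
      ((1 - Real.cos ((3 : ℕ) * (2 * Real.pi / L))) / (2 * Real.pi / L) ^ 2) := by
  unfold xTrue; simp

/-- coordinate `18`. -/
theorem xTrue_18 : xTrue L Δ lam2 f a 18 = Real.cos (2 * Real.pi / L / 2) := by
  unfold xTrue; simp

/-- the propagator block. -/
theorem xTrue_ghat {i : ℕ} (hi : i < 48) :
    xTrue L Δ lam2 f a (19 + i) = (2 * Real.pi / L) ^ 2 * gres L lam2 (B1.toTor L ((gridPts 3)[i]'(by
      rw [length_gridPts_three]; exact hi))) := by
  unfold xTrue
  simp only [show ¬ (19 + i < 16) by omega, show (19 + i ≠ 16) by omega, show (19 + i ≠ 17) by omega,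
    show (19 + i ≠ 18) by omega, show (19 + i < 67) by omega, if_false, if_true, Nat.add_sub_cancel_left]
  rw [List.getD_eq_getElem]

/-- the tail block. -/
theorem xTrue_tt {i : ℕ} (hi : i < 48) :
    xTrue L Δ lam2 f a (67 + i) = (2 * Real.pi / L) ^ 2 * tfun L Δ f (B1.toTor L ((gridPts 3)[i]'(by
      rw [length_gridPts_three]; exact hi))) := by
  unfold xTrue
  simp only [show ¬ (67 + i < 16) by omega, show (67 + i ≠ 16) by omega, show (67 + i ≠ 17) by omega,
    show (67 + i ≠ 18) by omega, show ¬ (67 + i < 67) by omega, show (67 + i < 115) by omega, if_false, if_true,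
    Nat.add_sub_cancel_left]
  rw [List.getD_eq_getElem]

/-- the cosine block. -/
theorem xTrue_cos {i : ℕ} (hi : i < 3) :
    xTrue L Δ lam2 f a (115 + i) = Real.cos (((i + 1 : ℕ) : ℝ) * (2 * Real.pi / L)) := by
  unfold xTrue
  simp only [show ¬ (115 + i < 16) by omega, show (115 + i ≠ 16) by omega, show (115 + i ≠ 17) by omega,
    show (115 + i ≠ 18) by omega, show ¬ (115 + i < 67) by omega, show ¬ (115 + i < 115) by omega,
    show (115 + i < 118) by omega, if_false, if_true, show 115 + i - 114 = i + 1 by omega]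

/-- the `w` block. -/
theorem xTrue_w {i : ℕ} (hi : i < 3) :
    xTrue L Δ lam2 f a (118 + i) = (1 - Real.cos (((i + 1 : ℕ) : ℝ) * (2 * Real.pi / L))) / (2 * Real.pi / L) ^ 2 := by
  unfold xTrue
  simp only [show ¬ (118 + i < 16) by omega, show (118 + i ≠ 16) by omega, show (118 + i ≠ 17) by omega,
    show (118 + i ≠ 18) by omega, show ¬ (118 + i < 67) by omega, show ¬ (118 + i < 115) by omega,
    show ¬ (118 + i < 118) by omega, show (118 + i < 121) by omega, if_false, if_true, show 118 + i - 117 = i + 1 by omega]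

/-! ## Inequality-only spec predicate -/

/-- the spec inequalities from position `k` on (no bookkeeping). -/
def SpecsIneq (X : ℕ → ℝ) : ℕ → List (RExpr × RExpr) → Prop
  | _, [] => True
  | k, s :: rest => (s.1.eval X ≤ X k ∧ X k ≤ s.2.eval X) ∧ SpecsIneq X (k + 1) rest

/-- entrywise form. -/
theorem specsIneq_get (X : ℕ → ℝ) : ∀ (l : List (RExpr × RExpr)) (k : ℕ), SpecsIneq X k l →
    ∀ j (hj : j < l.length), (l[j].1).eval X ≤ X (k + j) ∧ X (k + j) ≤ (l[j].2).eval X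
  | [], _, _, j, hj => by simp at hj
  | s :: rest, k, h, 0, _ => by simpa using h.1
  | s :: rest, k, h, j + 1, hj => by
      have := specsIneq_get X rest (k + 1) h.2 j (by simpa using hj)
      rw [show k + (j + 1) = k + 1 + j by omega]
      simpa using this

/-- concatenation. -/
theorem specsIneq_append (X : ℕ → ℝ) : ∀ (l₁ l₂ : List (RExpr × RExpr)) (k : ℕ), SpecsIneq X k l₁ →
    SpecsIneq X (k + l₁.length) l₂ → SpecsIneq X k (l₁ ++ l₂)
  | [], l₂, k, _, h2 => by simpa using h2
  | s :: rest, l₂, k, h1, h2 => by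
      refine ⟨h1.1, specsIneq_append X rest l₂ (k + 1) h1.2 ?_⟩
      rw [show k + 1 + rest.length = k + (s :: rest).length by simp; omega]; exact h2

/-- mapped family. -/
theorem specsIneq_map {α : Type} (X : ℕ → ℝ) (g : α → RExpr × RExpr) : ∀ (G : List α) (k : ℕ),
    (∀ i (hi : i < G.length), (g G[i]).1.eval X ≤ X (k + i) ∧ X (k + i) ≤ (g G[i]).2.eval X) → SpecsIneq X k (G.map g)
  | [], _, _ => trivial
  | q :: rest, k, h => by
      have h0 := h 0 (by simp)
      simp only [List.getElem_cons_zero, Nat.add_zero] at h0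
      refine ⟨h0, specsIneq_map X g rest (k + 1) ?_⟩
      intro i hi
      have := h (i + 1) (by simp; omega)
      rw [show k + 1 + i = k + (i + 1) by omega]
      simpa using this

/-! ## The spec memberships of the true vector -/

/-- the tail-block inequalities (hypothesis of `xTrue_specs`; discharged from `TtailBounds` + the dictionary). -/
def TtSpecs : Prop :=
  ∀ i (hi : i < 48),
    (ttLoE 3 ((gridPts 3)[i]'(by rw [length_gridPts_three]; exact hi))).eval (xTrue L Δ lam2 f a) ≤ xTrue L Δ lam2 f a (67 + i) ∧
    xTrue L Δ lam2 f a (67 + i) ≤ (ttHiE 3 ((gridPts 3)[i]'(by rw [length_gridPts_three]; exact hi))).eval (xTrue L Δ lam2 f a)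

/-- `eps` and `uu` at the point: `ε = θ²/(4π²)`, `u = 1 − a + aε`. -/
theorem eval_eps_uu (x : ℕ → ℝ) :
    eps.eval x = x 0 * (4 * x 1)⁻¹ ∧ uu.eval x = 1 - x 3 + x 3 * (x 0 * (4 * x 1)⁻¹) := by
  simp only [eps, uu, RExpr.eval, cst, vT, vPi2, vA]; push_cast; exact ⟨by ring, by ring⟩

/-- ★ **SPEC MEMBERSHIPS OF THE TRUE VECTOR** (`M₂ = 2`): for `L ≥ 12`, `0 < ν = λ₂/θ² < 4/π²`, `0 ≤ a`, `0 < 1 − a + aθ²/(4π²)`,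
and the tail-block inequalities `TtSpecs`, every spec of `specs 2` holds at `xTrue`. -/
theorem xTrue_specs (hL : 12 ≤ L) (hν0 : 0 < lam2 / (2 * Real.pi / L) ^ 2)
    (hν : lam2 / (2 * Real.pi / L) ^ 2 < 4 / Real.pi ^ 2) (ha : 0 ≤ a)
    (hu : 0 < 1 - a + a * ((2 * Real.pi / L) ^ 2 * (4 * Real.pi ^ 2)⁻¹)) (htt : TtSpecs L Δ lam2 f a) :
    ∀ j (hj : j < (specs 2).length),
      ((specs 2)[j].1).eval (xTrue L Δ lam2 f a) ≤ xTrue L Δ lam2 f a (16 + j) ∧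
      xTrue L Δ lam2 f a (16 + j) ≤ ((specs 2)[j].2).eval (xTrue L Δ lam2 f a) := by
  set X := xTrue L Δ lam2 f a with hXdef
  set θ : ℝ := 2 * Real.pi / L with hθdef
  have hLpos : (0 : ℝ) < L := by exact_mod_cast (show 0 < L by omega)
  have hL12 : (12 : ℝ) ≤ L := by exact_mod_cast hL
  have hπ := Real.pi_pos
  have hθ : 0 < θ := by positivity
  have hθle : θ * 6 ≤ Real.pi := by
    rw [hθdef, div_mul_eq_mul_div, div_le_iff₀ hLpos]; nlinarith
  have hX0 : X 0 = θ ^ 2 := xTrue_zero L Δ lam2 f a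
  have hmθ : ∀ m : ℕ, m ≤ 3 → |(m : ℝ) * θ| ≤ Real.pi := by
    intro m hm
    have hm' : (m : ℝ) ≤ 3 := by exact_mod_cast hm
    rw [abs_of_nonneg (by positivity)]; nlinarith
  apply specsIneq_get
  unfold specs
  -- [e1, em, cosHalf] ++ ghat ++ tt ++ cos ++ w
  refine specsIneq_append X _ _ 16 ?_ ?_
  · refine specsIneq_append X _ _ 16 ?_ ?_
    · refine specsIneq_append X _ _ 16 ?_ ?_
      · refine specsIneq_append X _ _ 16 ?_ ?_
        · -- the three scalars
          refine ⟨?_, ⟨?_, ⟨?_, trivial⟩⟩⟩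
          · exact e1Spec_holds X θ hθ (by linarith) hX0 (xTrue_16 L Δ lam2 f a)
          · -- ε*
            have e17 := xTrue_17 L Δ lam2 f a
            have hP2 : L2.point L lam2 a 2 = X 2 := (xTrue_lt16 L Δ lam2 f a (by norm_num)).symm
            have hP3 : L2.point L lam2 a 3 = X 3 := (xTrue_lt16 L Δ lam2 f a (by norm_num)).symm
            have hagree : ∀ i, i < 16 → L2.point L lam2 a i = X i := fun i hi => (xTrue_lt16 L Δ lam2 f a hi).symm
            have heps : eps.eval (L2.point L lam2 a) = eps.eval X :=
              eval_congr_below (n := 16) hagree eps (by simp [varsBelow, eps, vT, vPi2, cst])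
            have huu : uu.eval (L2.point L lam2 a) = uu.eval X :=
              eval_congr_below (n := 16) hagree uu (by simp [varsBelow, uu, eps, vT, vPi2, vA, cst])
            rw [hP2, hP3, heps, huu] at e17
            have hX2 : X 2 = lam2 / θ ^ 2 := by rw [← hP2]; rfl
            have hX3 : X 3 = a := by rw [← hP3]; rfl
            have hX1 : X 1 = Real.pi ^ 2 := by rw [← hagree 1 (by norm_num)]; rfl
            obtain ⟨ee, eu⟩ := eval_eps_uu X
            refine emSpec_holds X θ hθ 3 (hmθ 3 le_rfl) hX0 ?_ ?_ e17
            · rw [ee, eu, hX3, hX2, hX0, hX1]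
              have h1 : 0 < θ ^ 2 * (4 * Real.pi ^ 2)⁻¹ := by positivity
              have h2 : 0 < 3 * (lam2 / θ ^ 2) * (1 - a + a * (θ ^ 2 * (4 * Real.pi ^ 2)⁻¹)) := by positivity
              positivity
            · rw [hX2]
              have h4 : (4 : ℝ) / Real.pi ^ 2 < 1 := by
                rw [div_lt_one (by positivity)]; nlinarith [Real.pi_gt_three]
              have hν1 : lam2 / θ ^ 2 < 1 := by linarith
              have hθ1 : θ ≤ 0.525 := by nlinarith [Real.pi_lt_d2]
              have hθ2 : θ ^ 2 ≤ 0.28 := by nlinarith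
              norm_num
              nlinarith
          · exact cosHalfSpec_holds X θ hX0 (xTrue_18 L Δ lam2 f a)
        · -- the propagator block
          apply specsIneq_map
          intro i hi
          have hi48 : i < 48 := by rw [length_gridPts_three] at hi; exact hi
          rw [show 16 + [e1Spec, emSpec (2 + 1), cosHalfSpec].length + i = 19 + i by simp]
          rw [hXdef, xTrue_ghat L Δ lam2 f a hi48]
          set q := (gridPts 3)[i] with hq
          have hqW : q ∈ zWindow 3 := gridPts_three_window q (List.getElem_mem hi)
          obtain ⟨h1, h2⟩ := L2.ghat_bounds L lam2 a 3 (by omega) q hqW hν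
          have hagree : ∀ i, i < 16 → L2.point L lam2 a i = xTrue L Δ lam2 f a i :=
            fun i hi => (xTrue_lt16 L Δ lam2 f a hi).symm
          rw [eval_congr_below (n := 16) hagree _ (by simp [varsBelow, L2.ghatLoE])] at h1
          rw [eval_congr_below (n := 16) hagree _ (by simp [varsBelow, L2.ghatHiE])] at h2
          exact ⟨h1, h2⟩
      · -- the tail block (hypothesis)
        apply specsIneq_map
        intro i hi
        have hi48 : i < 48 := by rw [length_gridPts_three] at hi; exact hi
        rw [show 16 + ([e1Spec, emSpec (2 + 1), cosHalfSpec] ++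
            List.map (fun q => (L2.ghatLoE q, L2.ghatHiE q)) (gridPts (2 + 1))).length + i = 67 + i by
          simp [length_gridPts_three]]
        exact htt i hi48
    · -- cosines
      apply specsIneq_map
      intro i hi
      simp only [List.length_range] at hi
      rw [show 16 + ([e1Spec, emSpec (2 + 1), cosHalfSpec] ++
          List.map (fun q => (L2.ghatLoE q, L2.ghatHiE q)) (gridPts (2 + 1)) ++
          List.map (fun q => (ttLoE (2 + 1) q, ttHiE (2 + 1) q)) (gridPts (2 + 1))).length + i = 115 + i by
        simp [length_gridPts_three]]
      rw [List.getElem_range]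
      have hc := xTrue_cos L Δ lam2 f a hi
      rw [← hXdef] at hc
      exact cosSpec_holds X θ (i + 1) (115 + i) (hmθ (i + 1) (by omega)) hX0 hc
  · -- w
    apply specsIneq_map
    intro i hi
    simp only [List.length_range] at hi
    rw [show 16 + ([e1Spec, emSpec (2 + 1), cosHalfSpec] ++
        List.map (fun q => (L2.ghatLoE q, L2.ghatHiE q)) (gridPts (2 + 1)) ++
        List.map (fun q => (ttLoE (2 + 1) q, ttHiE (2 + 1) q)) (gridPts (2 + 1)) ++
        List.map (fun i => cosSpec (i + 1)) (List.range (2 + 1))).length + i = 118 + i by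
      simp [length_gridPts_three]]
    rw [List.getElem_range]
    have hc := xTrue_w L Δ lam2 f a hi
    rw [← hXdef] at hc
    exact wSpec_holds X θ hθ (i + 1) (118 + i) (hmθ (i + 1) (by omega)) hX0 hc

end Summit.HubbardSuperconductivity.HubbardSuperconductivity.Theorems.AnisotropyChord.Transfer.Fibre3.L2.N1
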